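import Summits.AtomisticToContinuum.Crystallization.Theorems.OverbindingBudgetAffineCompressedCutReading

/-!
# Overbinding budget, R4 «LR(r₁)» part XIII — FRAME: LR(r₁) from the leaf's hypothesis `AffDeepReg 12 10⁻⁴ 10⁻³ (1/450)`

Route `OverbindingBudget`, crux `RobustDefectLimitWindows`, open leaf `NearFieldSlackMinSecond 12 (1/25)` =
`∀ δ ∈ (0,2], NearFieldSlackSecondAt 64 12 (1/10^4) (1/1000) (17/50) (17/20) (3/50) (1/450) δ 12 (1/25)`, whose site hypothesis is
`Priced … y i → AffDeepReg 12 (1/10^4) (1/1000) (1/450) y i ∧ nearestDist y i < 17/20 → …`.  JOINT SUFFICIENCY (critic row 1466): the five ball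
hypotheses of the whole layer-rigidity cone (hP, hA at `1/1000`, hf at `1/10^4`, hinj, hex at `3/2 + 1/450`, on the `12ν`-ball) and the two frame
bounds (`399/400`, `401/400`) of `ν • A i` are EXACTLY what `AffDeepReg 12 (1/10^4) (1/1000) (1/450) y i` provides — no tolerance is tightened:

* `frame_upper` (`‖A z‖ ≤ (1 + 5θ/2)‖z‖`, the mirror of «Establish».`frame_lower`), `base_upper` (`θ = 1/1000`: `401/400`);
* ★ `charts_of_affDeepReg`: chart DATA `A, Qf, P, f` on `Fin N` (choice; junk outside the ball) with the five ball hypotheses VERBATIM as consumed by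
  «Run» … «Reading», plus `hBlo` («Establish».`base_lower`) and `hBup` (`base_upper`);
* ★★★ `layer_rigidity_of_affDeepReg`: `Function.Injective y → 0 < nearestDist y i → AffDeepReg 12 (1/10^4) (1/1000) (1/450) y i →` chart data with
  the five ball hypotheses ∧ LR(r₁) («Reading».`layer_rigidity_record`, all six clauses) in the frame `(ν • A i) ∘ Φ_s`.  At a priced site of the leaf
  `0 < δ ≤ nearestDist y i` («CompressedCutA».`nearestDist_pos_of_priced`), so this is LR(r₁) under the leaf's hypotheses alone.
-/

namespace Summit.AtomisticToContinuum.Crystallization.Theorems.OverbindingBudgetAffineCompressedCutFrame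

open Literature.Geometry.DiscreteGeometry (nearestDist nearestDist_nonneg fccTwoShellPattern hcpTwoShellPattern)
open Summit.AtomisticToContinuum.Crystallization.Theorems.OverbindingBudgetAffineLadder (AffFramed AffDeepReg)
open Summit.AtomisticToContinuum.Crystallization.Theorems.OverbindingBudgetAffineCompressedCutOp (op_of_tetra_bound_all)
open Summit.AtomisticToContinuum.Crystallization.Theorems.OverbindingBudgetAffineCompressedCutStep (tetra_exists_pattern)
open Summit.AtomisticToContinuum.Crystallization.Theorems.OverbindingBudgetAffineCompressedCutKernel (T3 tsub tadd thsum fccL fccNegL hcpL hcpAltL)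
open Summit.AtomisticToContinuum.Crystallization.Theorems.OverbindingBudgetAffineCompressedCutCharts (mv norm_mv_eq_one_iff listedBy_fcc listedBy_hcp)
open Summit.AtomisticToContinuum.Crystallization.Theorems.OverbindingBudgetAffineCompressedCutEstablish (Estab base_lower)
open Summit.AtomisticToContinuum.Crystallization.Theorems.OverbindingBudgetAffineCompressedCutEstablishTwo (IsSign flipIso)
open Summit.AtomisticToContinuum.Crystallization.Theorems.OverbindingBudgetAffineCompressedCutSeed (InLayer)
open Summit.AtomisticToContinuum.Crystallization.Theorems.OverbindingBudgetAffineCompressedCutPatch (capv dL)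
open Summit.AtomisticToContinuum.Crystallization.Theorems.OverbindingBudgetAffineCompressedCutBudget (tauR dR)
open Summit.AtomisticToContinuum.Crystallization.Theorems.OverbindingBudgetAffineCompressedCutReading (layer_rigidity_record)

variable {N : ℕ}

/-- **FRAME UPPER BOUND**: a linear map `θ`-close to a linear isometry on a two-shell pattern satisfies `‖A z‖ ≤ (1 + (5/2)θ)·‖z‖` for every `z`
(the mirror of «Establish».`frame_lower`; tetrahedral op-norm bound `op_of_tetra_bound_all`). [this file] -/
theorem frame_upper {θ : ℝ} {A : EuclideanSpace ℝ (Fin 3) →ₗ[ℝ] EuclideanSpace ℝ (Fin 3)} {Q : EuclideanSpace ℝ (Fin 3) →ₗᵢ[ℝ] EuclideanSpace ℝ (Fin 3)}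
    {P : Finset (EuclideanSpace ℝ (Fin 3))} (hP : P = fccTwoShellPattern ∨ P = hcpTwoShellPattern) (hA : ∀ v ∈ P, ‖A v - Q v‖ ≤ θ) :
    ∀ z, ‖A z‖ ≤ (1 + 5 / 2 * θ) * ‖z‖ := by
  have hvk : mv (3, 3, 0) ∈ P := by
    rcases hP with rfl | rfl
    · exact listedBy_fcc.2 _ (by decide)
    · exact listedBy_hcp.2 _ (by decide)
  have hvk1 : ‖mv (3, 3, 0)‖ = 1 := (norm_mv_eq_one_iff _).2 (by decide)
  obtain ⟨b, hb, c, hc, hb1, hc1, -, -, -, ivb, ivc, ibc⟩ := tetra_exists_pattern hP hvk hvk1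
  have hM : ∀ w ∈ P, ‖(A - Q.toLinearMap) w‖ ≤ θ := fun w hw => by
    rw [LinearMap.sub_apply, LinearIsometry.coe_toLinearMap]; exact hA w hw
  have hop := op_of_tetra_bound_all (M := A - Q.toLinearMap) hvk1 hb1 hc1 ivb ivc ibc (hM _ hvk) (hM b hb) (hM c hc)
  intro z
  have h1 := hop z
  rw [LinearMap.sub_apply, LinearIsometry.coe_toLinearMap] at h1
  have h2 : ‖A z‖ - ‖Q z‖ ≤ ‖A z - Q z‖ := norm_sub_norm_le _ _
  rw [Q.norm_map] at h2
  linarith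

/-- **The base frame is bounded above**: `‖(nn_i·A_i) z‖ ≤ (401/400)·nn_i·‖z‖` at the record frame tolerance `10⁻³`. [this file] -/
theorem base_upper {y : Fin N → EuclideanSpace ℝ (Fin 3)} {i : Fin N} {Ai : EuclideanSpace ℝ (Fin 3) →ₗ[ℝ] EuclideanSpace ℝ (Fin 3)}
    {Qi : EuclideanSpace ℝ (Fin 3) →ₗᵢ[ℝ] EuclideanSpace ℝ (Fin 3)} {Pi : Finset (EuclideanSpace ℝ (Fin 3))}
    (hP : Pi = fccTwoShellPattern ∨ Pi = hcpTwoShellPattern) (hA : ∀ v ∈ Pi, ‖Ai v - Qi v‖ ≤ 1 / 1000) :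
    ∀ z, ‖(nearestDist y i • Ai) z‖ ≤ 401 / 400 * nearestDist y i * ‖z‖ := by
  intro z
  have h := frame_upper hP hA z
  rw [LinearMap.smul_apply, norm_smul, Real.norm_of_nonneg (nearestDist_nonneg y i)]
  have h0 := nearestDist_nonneg y i
  nlinarith [norm_nonneg z]

/-- ★ **CHART DATA FROM AFFINE DEEP REGISTRATION.**  `AffDeepReg 12 (1/10^4) (1/1000) (1/450) y i` provides chart data `A, Qf, P, f` on all of `Fin N`
(by choice on the `12ν`-ball, junk elsewhere) satisfying the five ball hypotheses of the layer-rigidity cone VERBATIM and the two base-frame bounds. [this file] -/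
theorem charts_of_affDeepReg {y : Fin N → EuclideanSpace ℝ (Fin 3)} {i : Fin N} (hreg : AffDeepReg 12 (1 / 10 ^ 4) (1 / 1000) (1 / 450) y i) :
    ∃ (A : Fin N → (EuclideanSpace ℝ (Fin 3) →ₗ[ℝ] EuclideanSpace ℝ (Fin 3))) (Qf : Fin N → (EuclideanSpace ℝ (Fin 3) →ₗᵢ[ℝ] EuclideanSpace ℝ (Fin 3)))
      (P : Fin N → Finset (EuclideanSpace ℝ (Fin 3))) (f : Fin N → EuclideanSpace ℝ (Fin 3) → EuclideanSpace ℝ (Fin 3)),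
      (∀ j, dist (y j) (y i) ≤ 12 * nearestDist y i → (P j = fccTwoShellPattern ∨ P j = hcpTwoShellPattern)) ∧
      (∀ j, dist (y j) (y i) ≤ 12 * nearestDist y i → ∀ v ∈ P j, ‖A j v - Qf j v‖ ≤ 1 / 1000) ∧
      (∀ j, dist (y j) (y i) ≤ 12 * nearestDist y i → ∀ v ∈ P j,
        f j v ∈ Set.range y ∧ dist (f j v) (y j + nearestDist y j • A j v) ≤ 1 / 10 ^ 4 * nearestDist y j) ∧
      (∀ j, dist (y j) (y i) ≤ 12 * nearestDist y i → Set.InjOn (f j) ↑(P j)) ∧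
      (∀ j, dist (y j) (y i) ≤ 12 * nearestDist y i → ∀ m, m ≠ j → dist (y m) (y j) ≤ (3 / 2 + 1 / 450) * nearestDist y j →
        ∃ v ∈ P j, f j v = y m) ∧
      (∀ z, 399 / 400 * nearestDist y i * ‖z‖ ≤ ‖(nearestDist y i • A i) z‖) ∧
      (∀ z, ‖(nearestDist y i • A i) z‖ ≤ 401 / 400 * nearestDist y i * ‖z‖) := by
  classical
  have key : ∀ j : Fin N, ∃ (Q : EuclideanSpace ℝ (Fin 3) →ₗᵢ[ℝ] EuclideanSpace ℝ (Fin 3)) (A : EuclideanSpace ℝ (Fin 3) →ₗ[ℝ] EuclideanSpace ℝ (Fin 3))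
      (P : Finset (EuclideanSpace ℝ (Fin 3))) (f : EuclideanSpace ℝ (Fin 3) → EuclideanSpace ℝ (Fin 3)), dist (y j) (y i) ≤ 12 * nearestDist y i →
      (P = fccTwoShellPattern ∨ P = hcpTwoShellPattern) ∧ (∀ v ∈ P, ‖A v - Q v‖ ≤ 1 / 1000) ∧
      (∀ v ∈ P, f v ∈ Set.range y ∧ dist (f v) (y j + nearestDist y j • A v) ≤ 1 / 10 ^ 4 * nearestDist y j) ∧ Set.InjOn f ↑P ∧
      ∀ k : Fin N, k ≠ j → dist (y k) (y j) ≤ (3 / 2 + 1 / 450) * nearestDist y j → ∃ v ∈ P, f v = y k := by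
    intro j
    by_cases h : dist (y j) (y i) ≤ 12 * nearestDist y i
    · obtain ⟨Q, A, P, f, hF⟩ := (hreg j h).2
      exact ⟨Q, A, P, f, fun _ => hF⟩
    · exact ⟨LinearIsometry.id, 0, fccTwoShellPattern, fun _ => y j, fun h' => absurd h' h⟩
  choose Qf A P f hF using key
  have hPi := (hF i (by rw [dist_self]; exact mul_nonneg (by norm_num) (nearestDist_nonneg y i))).1
  have hAi := (hF i (by rw [dist_self]; exact mul_nonneg (by norm_num) (nearestDist_nonneg y i))).2.1
  exact ⟨A, Qf, P, f, fun j hj => (hF j hj).1, fun j hj => (hF j hj).2.1, fun j hj => (hF j hj).2.2.1, fun j hj => (hF j hj).2.2.2.1,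
    fun j hj => (hF j hj).2.2.2.2, base_lower hPi hAi, base_upper hPi hAi⟩

/-- ★★★ **LAYER RIGIDITY LR(r₁) UNDER THE LEAF'S HYPOTHESIS.**  From `Function.Injective y`, `0 < nearestDist y i` and
`AffDeepReg 12 (1/10^4) (1/1000) (1/450) y i` ALONE: chart data with the five ball hypotheses, and the six clauses of «Reading».`layer_rigidity_record`
in the frame `(ν • A i) ∘ Φ_s`. [this file] -/
theorem layer_rigidity_of_affDeepReg {y : Fin N → EuclideanSpace ℝ (Fin 3)} (hy : Function.Injective y) {i : Fin N} (hν : 0 < nearestDist y i)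
    (hreg : AffDeepReg 12 (1 / 10 ^ 4) (1 / 1000) (1 / 450) y i) :
    ∃ (A : Fin N → (EuclideanSpace ℝ (Fin 3) →ₗ[ℝ] EuclideanSpace ℝ (Fin 3))) (Qf : Fin N → (EuclideanSpace ℝ (Fin 3) →ₗᵢ[ℝ] EuclideanSpace ℝ (Fin 3)))
      (P : Fin N → Finset (EuclideanSpace ℝ (Fin 3))) (f : Fin N → EuclideanSpace ℝ (Fin 3) → EuclideanSpace ℝ (Fin 3)),
      (∀ j, dist (y j) (y i) ≤ 12 * nearestDist y i → (P j = fccTwoShellPattern ∨ P j = hcpTwoShellPattern)) ∧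
      (∀ j, dist (y j) (y i) ≤ 12 * nearestDist y i → ∀ v ∈ P j, ‖A j v - Qf j v‖ ≤ 1 / 1000) ∧
      (∀ j, dist (y j) (y i) ≤ 12 * nearestDist y i → ∀ v ∈ P j,
        f j v ∈ Set.range y ∧ dist (f j v) (y j + nearestDist y j • A j v) ≤ 1 / 10 ^ 4 * nearestDist y j) ∧
      (∀ j, dist (y j) (y i) ≤ 12 * nearestDist y i → Set.InjOn (f j) ↑(P j)) ∧
      (∀ j, dist (y j) (y i) ≤ 12 * nearestDist y i → ∀ m, m ≠ j → dist (y m) (y j) ≤ (3 / 2 + 1 / 450) * nearestDist y j →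
        ∃ v ∈ P j, f j v = y m) ∧
      ∃ (s : T3) (hs : IsSign s) (ref : ℤ → T3) (Cz : ℤ → List T3) (e : ℤ → ℤ),
        (∀ ℓ : ℤ, -5 ≤ ℓ → ℓ ≤ 5 → Cz ℓ ∈ [fccL, fccNegL, hcpL, hcpAltL] ∧ thsum (ref ℓ) = 6 * ℓ ∧ (ref ℓ).2.1 = (ref ℓ).1 ∧
          (3 : ℤ) ∣ ((ref ℓ).2.1 - (ref ℓ).2.2) ∧
          ∀ u : T3, InLayer (tsub (tadd (2 * ℓ, 2 * ℓ, 2 * ℓ) u) (ref ℓ)) → |u.1| ≤ 18 - |ℓ| → |u.2.1| ≤ 18 - |ℓ| → |u.2.2| ≤ 18 - |ℓ| →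
            ∃ k : Fin N, ∃ M : EuclideanSpace ℝ (Fin 3) →ₗᵢ[ℝ] EuclideanSpace ℝ (Fin 3),
              dist (y k) (y i) ≤ 12 * nearestDist y i ∧ 9026 / 10000 * nearestDist y i ≤ nearestDist y k ∧
              nearestDist y k ≤ 10347 / 10000 * nearestDist y i ∧
              Estab y A P ((nearestDist y i • A i) ∘ₗ (flipIso s hs).toLinearMap) i k M (Cz ℓ) (tadd (2 * ℓ, 2 * ℓ, 2 * ℓ) u)
                (tauR (nearestDist y i) 31) (dR (nearestDist y i) 31)) ∧
        (∀ ℓ : ℤ, -5 ≤ ℓ → ℓ ≤ 4 → (e ℓ = 1 ∨ e ℓ = -1) ∧ ref (ℓ + 1) = tadd (ref ℓ) (capv 1 (e ℓ) (1, 1, -2)) ∧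
          (∀ δ ∈ dL, capv 1 (e ℓ) δ ∈ Cz ℓ) ∧ (∀ δ ∈ dL, capv (-1) (-(e ℓ)) δ ∈ Cz (ℓ + 1))) ∧
        (∃ x₀ : T3, InLayer x₀ ∧ tadd (ref 0) x₀ = (0, 0, 0)) ∧
        (∀ m, dist (y m) (y i) ≤ 106 / 25 * nearestDist y i → ∃ (ℓ : ℤ) (x : T3), -5 ≤ ℓ ∧ ℓ ≤ 5 ∧ InLayer x ∧
          ‖y m - y i - ((nearestDist y i • A i) ∘ₗ (flipIso s hs).toLinearMap) (mv (tadd (ref ℓ) x))‖ ≤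
            dR (nearestDist y i) 31 + 1 / 10 ^ 4 * (10347 / 10000 * nearestDist y i) + tauR (nearestDist y i) 31 ∧
          9967 / 10000 * (9026 / 10000 * nearestDist y i) ≤ nearestDist y m) ∧
        (∀ (m m' : Fin N) (r : T3), 9967 / 10000 * (9026 / 10000 * nearestDist y i) ≤ nearestDist y m' →
          ‖y m - y i - ((nearestDist y i • A i) ∘ₗ (flipIso s hs).toLinearMap) (mv r)‖ ≤
            dR (nearestDist y i) 31 + 1 / 10 ^ 4 * (10347 / 10000 * nearestDist y i) + tauR (nearestDist y i) 31 →
          ‖y m' - y i - ((nearestDist y i • A i) ∘ₗ (flipIso s hs).toLinearMap) (mv r)‖ ≤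
            dR (nearestDist y i) 31 + 1 / 10 ^ 4 * (10347 / 10000 * nearestDist y i) + tauR (nearestDist y i) 31 → m = m') ∧
        (∀ (m : Fin N) (ℓ : ℤ) (x : T3) (ℓ' : ℤ) (x' : T3), -5 ≤ ℓ → ℓ ≤ 5 → -5 ≤ ℓ' → ℓ' ≤ 5 → InLayer x → InLayer x' →
          ‖y m - y i - ((nearestDist y i • A i) ∘ₗ (flipIso s hs).toLinearMap) (mv (tadd (ref ℓ) x))‖ ≤
            dR (nearestDist y i) 31 + 1 / 10 ^ 4 * (10347 / 10000 * nearestDist y i) + tauR (nearestDist y i) 31 →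
          ‖y m - y i - ((nearestDist y i • A i) ∘ₗ (flipIso s hs).toLinearMap) (mv (tadd (ref ℓ') x'))‖ ≤
            dR (nearestDist y i) 31 + 1 / 10 ^ 4 * (10347 / 10000 * nearestDist y i) + tauR (nearestDist y i) 31 →
          tadd (ref ℓ) x = tadd (ref ℓ') x') := by
  obtain ⟨A, Qf, P, f, hP, hA, hf, hinj, hex, hBlo, hBup⟩ := charts_of_affDeepReg hreg
  exact ⟨A, Qf, P, f, hP, hA, hf, hinj, hex, layer_rigidity_record hy hν hP hA hf hinj hex hBlo hBup⟩

end Summit.AtomisticToContinuum.Crystallization.Theorems.OverbindingBudgetAffineCompressedCutFrame
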